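/-
Copyright (c) 2026 the pub-hodgecm-mathlib formalisation cell (harness21).  Prover seat hodgecm-mathlib-K2E3-p37 (g2), Track B «K2-LIT» ∕ h413 =
`stmt-HodgeConjecture-24833`, line `K2_E3_EllipticInputs`, unit U4 «Keys», PART «U4Keys» socket :182 (U4f-χ₁-ram-one-pos)
`sig_K2E3KeysThmTwoContractingRamifiedCharOnePosDepth` (L4 line-lead K2E3-plan (g5); programme A_pos of this base's g0 memo): brick (iii)-W «NO UNIPOTENT WITNESS ON THE
WILD CELLS» — the kernel-checked heart of the design memo `K2/K2E3-p37/g2/MEMO-WildDyadicResidual.K2E3-p37-g2.md`: at a place where the trace of every integer is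
NON-unit (`Tr(𝒪_w) ⊆ 𝔭_v`: wildly ramified dyadic), an integral `u(y, b) ∈ N` conjugated by an intermediate `ū(x, z)` with `|x| ≤ |ϖ|ᵐ`, `|z| ≤ |ϖ|^{m+1}` has
`(ū⁻¹ u ū)₀₀ ≡ 1 (mod 𝔭^{m+1})`, so a character of conductor `≤ m + 1` cannot see it — the cell is θ-RELEVANT and the uniform-`J_{m+1}` road (★ p861548 … ★ p862457)
does not run there.  REPORT-FIRST 2026-09-04.
-/
import Summits.HodgeConjecture.HodgeConjecture.Theorems.K2E3LevelNDepthWitnessCover   -- ★ p862085: `v_le_of_lt_one` (discreteness); brings ★ p861919 `conj_upper_apply_zero_zero` (`j₀₀ = 1 − yσx + bz`)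
import Literature.NumberTheory.Automorphic.RamifiedPlaceDifferent                   -- ★ F0P3a-p06 (g18): `valued_galAdicCompletionMap_sub_self_le_of_mem_integer`, `…_le_exp_neg_one` (`σ_w ≡ id mod 𝔭_w` at a ramified place)
import HarnessLib

/-!
# K2 ∕ E3 «EllipticInputs», unit U4 «Keys» — (U4f-χ₁-ram-one-pos), programme A_pos brick (iii)-W: NO UNIPOTENT WITNESS ON THE WILD CELLS
# «`Tr(𝒪) ⊆ 𝔭` ⟹ for `|x| ≤ |ϖ|ᵐ`, `|z| ≤ |ϖ|^{m+1}` and integral `u(y,b) ∈ N`: `(ū(x,z)⁻¹ u ū(x,z))₀₀ ≡ 1 (mod 𝔭^{m+1})`»   [Serre1979 III §3, IV §1–§2; Roche1998 §4; Casselman1995 §6.3]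

Cell hodgecm-mathlib, Track B «K2-LIT», crux item H413 = stmt-HodgeConjecture-24833 (route `HCCMUnconditional`, no route verbs); target BY NAME the OPEN tier-0 leaf
`…K2E3EllipticInputs.U4Keys.sig_K2E3KeysThmTwoContractingRamifiedCharOnePosDepth` (U4Keys ED. 8 :182), design D-I «vanishing functional» at POSITIVE depth — its SCOPE.
Author K2E3-p37 (g2).  `--supports stmt-HodgeConjecture-24833 --as helper`; THEOREMS ONLY.  NOT THE PAYER — a NEGATIVE structural fact about the road.

THE POINT.  The depth witnesses ★ p862033∕p861978∕p862372 kill an intermediate cell `P·ū(x,z)·J_{m+1}` by an element `u(y, b) ∈ N` with `θ(ū⁻¹uū) = χ₁(1 + bz − yσx) ≠ 1`;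
in family X (`ord x = m`, `ord z ≥ m + 1`) `y = −c∕σx` is a UNIT and `b` solves `Tr b = −N(y)` (a unit of `F`) with `|b| ≤ 1` — possible iff `F`'s units are traces of integers
of `E`, i.e. iff the place is tame or unramified (`hT` of ★ p862457).  Where every integral trace is a NON-unit — the letter
  `hwild : ∀ a, |a| ≤ 1 → |a + σa| < 1`   (⟺ `Tr(𝒪_E) ⊆ 𝔭_F` ⟺ `E∕F` wildly ramified, `|2| < 1`; §3 derives it at a ramified CM place with `|2|_w < 1` from ★ `RamifiedPlaceDifferent`) —
NO integral `u(y, b)` works on the cells `|x| ≤ |ϖ|ᵐ`, `|z| ≤ |ϖ|^{m+1}`: `N(y) = −Tr(b)` is then a non-unit, so `|y| < 1`, `|y| ≤ |ϖ|` (discreteness), `|yσx| ≤ |ϖ|^{m+1}`, and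
`|bz| ≤ |z| ≤ |ϖ|^{m+1}`; hence `(ū⁻¹uū)₀₀ = 1 − yσx + bz ≡ 1 (mod 𝔭^{m+1})` (§2) and every `χ₁` of conductor `≤ m + 1` reads `1` on it (§2 `chi_conj_apply_zero_zero_eq_one_of_wild`).
Since the torus part of a Borel witness cancels (g0 memo §9) and `u = ū j ū⁻¹` must be integral, the cell `ord x = m`, `ord z ∈ {m+1, m+2}` (it exists once `m ≥ d + 3`,
memo §2) is θ-RELEVANT: the cell-family engine ★ p861573's letter `hwit` is false there and design D-I with `B = J_{m+1}` does not conclude at a wildly ramified dyadic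
place.  So the pos-A socket must carry a place letter (the weakest payable one is `hT`), and «`v ∣ 2` ramified, positive depth» is a separate open leaf.
* §1 `v_le_uniformizer_of_wild` — `hwild`, `b + σb + yσy = 0`, `|b| ≤ 1` ⟹ `|y| ≤ |ϖ|`.
* §2 **`v_conj_apply_zero_zero_sub_one_le_of_wild`** and its character reading `chi_conj_apply_zero_zero_eq_one_of_wild`; `not_wild_of_traceOne` (a trace-one integer refutes `hwild`).
* §3 `wild_of_ramified_of_v_two_lt_one` — the CM source of `hwild`: `w ∣ v` ramified and `|2|_w < 1` ⟹ `∀ a ∈ 𝒪_w, |a + σ_w a|_w < 1` (`a + σa = (σa − a) + 2a`, ★ `RamifiedPlaceDifferent` §6).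
HONEST LABEL: HC_CM is proved only modulo the 7 printed citations (2 remaining named inputs: hLiu418 = stmt-HodgeConjecture-24832, h413 = stmt-HodgeConjecture-24833)
until rung 0 closes; count-neutral — this file does NOT pay the leaf; it bounds the road.

## References
* [Serre1979] J.-P. Serre, *Local Fields*, GTM 67 (1979), Ch. III §3 Prop. 7 (`Tr(𝔭_E^k) = 𝔭_F^{⌊(k+d)∕e⌋}`), Ch. IV §1 Prop. 4, §2.
* [Roche1998] A. Roche, *Types and Hecke algebras for principal series representations of split reductive p-adic groups*, Ann. Sci. ÉNS (4) 31 (1998), §4.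
* [Casselman1995] W. Casselman, *Introduction to the theory of admissible representations of `p`-adic reductive groups* (1995), §6.3.
* [Rogawski1990] J. D. Rogawski, *Automorphic Representations of Unitary Groups in Three Variables*, Ann. of Math. Stud. 123 (1990), §1.10 p. 9.
-/

set_option autoImplicit false
-- the mandated namespace repeats the single-problem summit's segment (`HodgeConjecture.HodgeConjecture`)
set_option linter.dupNamespace false

noncomputable section

open NumberField IsDedekindDomain
open Matrix Literature.NumberTheory Literature.NumberTheory.Automorphic Literature.NumberTheory.Automorphic.UnitaryGroup
open scoped Matrix MatrixGroups WithZero Valued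

namespace Summit.HodgeConjecture.HodgeConjecture.Cruxes.H413.K2E3LevelNWildCellNoWitness

open Summit.HodgeConjecture.HodgeConjecture.Cruxes.H413
open Summit.HodgeConjecture.HodgeConjecture.Cruxes.H413.K2E3LevelNDepthWitnessCover

/-! ## §1–§2 Model `U(σ, Φ₃)(K)`: no unipotent witness under `hwild` -/

section Model

variable {K : Type*} [Field K] [Valued K ℤᵐ⁰]
  (σ : K →+* K) {ϖ : K} {J : Matrix (Fin 3) (Fin 3) K} (hJ : J = (StdForm.antidiagonal 3).over K)
  (hσ : ∀ a, σ (σ a) = a) (hvσ : ∀ a, Valued.v (σ a) = Valued.v a) (hvϖ : Valued.v ϖ = WithZero.exp (-1 : ℤ))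

include hvσ hvϖ in
/-- **§1 `|y| ≤ |ϖ|` under `hwild`**: if every integer has non-unit trace and `b + σb + yσy = 0` with `|b| ≤ 1`, then `|y|² = |b + σb| < 1`, so `|y| < 1`, i.e. `|y| ≤ |ϖ|`
(discreteness, ★ `v_le_of_lt_one`). [cite: Serre1979, Ch. III §3 Prop. 7] -/
theorem v_le_uniformizer_of_wild (hwild : ∀ a : K, Valued.v a ≤ 1 → Valued.v (a + σ a) < 1) {y b : K}
    (hrel : b + σ b + y * σ y = 0) (hb : Valued.v b ≤ 1) : Valued.v y ≤ Valued.v ϖ := by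
  have hyy : Valued.v y * Valued.v y < 1 := by
    have e : b + σ b = -(y * σ y) := by linear_combination hrel
    have h := hwild b hb
    rw [e, Valuation.map_neg, map_mul, hvσ] at h
    exact h
  have hy : Valued.v y < 1 := by
    by_contra h
    rw [not_lt] at h
    exact absurd (lt_of_le_of_lt (one_le_mul h h) hyy) (lt_irrefl 1)
  exact v_le_of_lt_one hvϖ hy

include hJ hσ hvσ hvϖ in
/-- **§2 NO UNIPOTENT WITNESS ON A WILD CELL.**  Under `hwild` (`Tr(𝒪) ⊆ 𝔭`), for `ū ∈ U(σ, Φ₃)` with matrix `ū(x, z)`, `|x| ≤ |ϖ|ᵐ`, `|z| ≤ |ϖ|^{m+1}`, and ANY `u ∈ U(σ, Φ₃)` with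
matrix `u(y, b)` (`b + σb + yσy = 0`) and `|b| ≤ 1`: `|(ū⁻¹ u ū)₀₀ − 1| ≤ |ϖ|^{m+1}` — because `(ū⁻¹ u ū)₀₀ = 1 − yσx + bz` (★ p861919), `|bz| ≤ |z|`, and `|y| ≤ |ϖ|` (§1).
So no `u ∈ N` conjugating into `K₀` separates `θ` from `χδ^{½}` on this cell: contrast ★ p862372 (family X uses a UNIT `y` there, available iff a trace-one integer exists).
[cite: Roche1998, §4] [cite: Casselman1995, §6.3] [cite: Serre1979, Ch. III §3 Prop. 7] -/
theorem v_conj_apply_zero_zero_sub_one_le_of_wild (hwild : ∀ a : K, Valued.v a ≤ 1 → Valued.v (a + σ a) < 1) {m : ℕ}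
    {nb u : ↥(unitaryGroupOfForm σ J)} {x z y b : K}
    (hnb : ((nb : GL (Fin 3) K) : Matrix (Fin 3) (Fin 3) K) = !![1, 0, 0; -σ x, 1, 0; z, x, 1])
    (hu : ((u : GL (Fin 3) K) : Matrix (Fin 3) (Fin 3) K) = !![1, y, b; 0, 1, -σ y; 0, 0, 1])
    (hrel : b + σ b + y * σ y = 0) (hb : Valued.v b ≤ 1) (hx : Valued.v x ≤ Valued.v ϖ ^ m) (hz : Valued.v z ≤ Valued.v ϖ ^ (m + 1)) :
    Valued.v ((((nb⁻¹ * u * nb : ↥(unitaryGroupOfForm σ J)) : GL (Fin 3) K) : Matrix (Fin 3) (Fin 3) K) 0 0 - 1) ≤ Valued.v ϖ ^ (m + 1) := by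
  rw [K2E3LowerUnipotentConjUpperEntries.conj_upper_apply_zero_zero σ hJ hσ hnb hu, show 1 - y * σ x + b * z - 1 = b * z - y * σ x by ring]
  have hy : Valued.v y ≤ Valued.v ϖ := v_le_uniformizer_of_wild σ hvσ hvϖ hwild hrel hb
  refine Valued.v.map_sub_le ?_ ?_
  · rw [map_mul]
    exact (mul_le_mul' hb hz).trans_eq (one_mul _)
  · rw [map_mul, hvσ, pow_succ']
    exact mul_le_mul' hy hx

include hJ hσ hvσ hvϖ in
/-- **The character reading**: for `χ₁ : Kˣ → ℂˣ` of conductor `≤ m + 1` (`χ₁ = 1` on `1 + 𝔭^{m+1}`), the `(0,0)` entry of `ū⁻¹ u ū` on a wild cell is a unit KILLED by `χ₁` —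
`θ(ū⁻¹ u ū) = 1 = (χδ^{½})(u)`: no disagreement, the cell is θ-relevant. [cite: Roche1998, §4] [cite: Casselman1995, §6.3] -/
theorem chi_conj_apply_zero_zero_eq_one_of_wild (hwild : ∀ a : K, Valued.v a ≤ 1 → Valued.v (a + σ a) < 1) {m : ℕ}
    (χ₁ : Kˣ →* ℂˣ) (hcond : ∀ e : Kˣ, Valued.v ((e : K) - 1) ≤ Valued.v ϖ ^ (m + 1) → χ₁ e = 1)
    {nb u : ↥(unitaryGroupOfForm σ J)} {x z y b : K}
    (hnb : ((nb : GL (Fin 3) K) : Matrix (Fin 3) (Fin 3) K) = !![1, 0, 0; -σ x, 1, 0; z, x, 1])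
    (hu : ((u : GL (Fin 3) K) : Matrix (Fin 3) (Fin 3) K) = !![1, y, b; 0, 1, -σ y; 0, 0, 1])
    (hrel : b + σ b + y * σ y = 0) (hb : Valued.v b ≤ 1) (hx : Valued.v x ≤ Valued.v ϖ ^ m) (hz : Valued.v z ≤ Valued.v ϖ ^ (m + 1)) :
    ∃ h0 : (((nb⁻¹ * u * nb : ↥(unitaryGroupOfForm σ J)) : GL (Fin 3) K) : Matrix (Fin 3) (Fin 3) K) 0 0 ≠ 0,
      χ₁ (Units.mk0 _ h0) = 1 := by
  have hle := v_conj_apply_zero_zero_sub_one_le_of_wild σ hJ hσ hvσ hvϖ hwild hnb hu hrel hb hx hz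
  have hvϖlt : Valued.v ϖ < 1 := by rw [hvϖ, ← WithZero.exp_zero, WithZero.exp_lt_exp]; norm_num
  have hlt : Valued.v ((((nb⁻¹ * u * nb : ↥(unitaryGroupOfForm σ J)) : GL (Fin 3) K) : Matrix (Fin 3) (Fin 3) K) 0 0 - 1) < 1 :=
    lt_of_le_of_lt hle (pow_lt_one' hvϖlt (Nat.succ_ne_zero m))
  have h1 : Valued.v ((((nb⁻¹ * u * nb : ↥(unitaryGroupOfForm σ J)) : GL (Fin 3) K) : Matrix (Fin 3) (Fin 3) K) 0 0) = 1 := by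
    rw [show (((nb⁻¹ * u * nb : ↥(unitaryGroupOfForm σ J)) : GL (Fin 3) K) : Matrix (Fin 3) (Fin 3) K) 0 0 =
        1 + ((((nb⁻¹ * u * nb : ↥(unitaryGroupOfForm σ J)) : GL (Fin 3) K) : Matrix (Fin 3) (Fin 3) K) 0 0 - 1) by ring]
    exact Valued.v.map_one_add_of_lt hlt
  have h0 : (((nb⁻¹ * u * nb : ↥(unitaryGroupOfForm σ J)) : GL (Fin 3) K) : Matrix (Fin 3) (Fin 3) K) 0 0 ≠ 0 := fun h => by
    rw [h, map_zero] at h1; exact zero_ne_one h1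
  exact ⟨h0, hcond _ (by rw [Units.val_mk0]; exact hle)⟩

/-- **A trace-one integer refutes `hwild`** (`|t + σt| = |1| = 1`): the scope of ★ p862457's letter `hT` and the wild regime are complementary. [cite: Serre1979, Ch. III §3] -/
theorem not_wild_of_traceOne {t : K} (ht : t + σ t = 1) (hvt : Valued.v t ≤ 1) :
    ¬ (∀ a : K, Valued.v a ≤ 1 → Valued.v (a + σ a) < 1) := fun hwild => by
  have h := hwild t hvt
  rw [ht, Valuation.map_one] at h
  exact lt_irrefl 1 h

end Model

/-! ## §3 The CM source of `hwild`: a ramified place with `|2|_w < 1` -/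

section CM

variable (L : Type) [Field L] [NumberField L] [IsCMField L] (v : HeightOneSpectrum (𝓞 ↥(maximalRealSubfield L)))
  (w : PlacesOver L v) (hw : IsCMField.complexConj L • w.1 = w.1)

/-- **`hwild` at a wildly ramified dyadic place.**  If `w ∣ v` is ramified (`e(w|v) ≠ 1`) and `|2|_w < 1`, then every `a ∈ 𝒪_w` has `|a + σ_w a|_w < 1`: `a + σ_w a = (σ_w a − a) + 2a`
with `|σ_w a − a| ≤ |σ_w τ − τ| ≤ exp(−1) < 1` (★ `RamifiedPlaceDifferent` §6, §4; `τ` a uniformiser) and `|2a| ≤ |2|_w < 1`.  (Equivalently `Tr_{L_w∕L⁺_v}(𝒪_w) ⊆ 𝔭_v`: different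
exponent `d ≥ 2`.) [cite: Serre1979, Ch. IV §1 Prop. 4, Ch. IV §2, Ch. III §3 Prop. 7] -/
theorem wild_of_ramified_of_v_two_lt_one (he : v.asIdeal.ramificationIdx' w.1.asIdeal ≠ 1) (h2 : Valued.v (2 : w.1.adicCompletion L) < 1) :
    ∀ a : w.1.adicCompletion L, Valued.v a ≤ 1 → Valued.v (a + galAdicCompletionMap (L := L) (IsCMField.complexConj L) hw a) < 1 := by
  intro a ha
  obtain ⟨π, hπ⟩ := w.1.valuation_exists_uniformizer L
  have hτ : Valued.v (π : w.1.adicCompletion L) = WithZero.exp (-1 : ℤ) := by rw [HeightOneSpectrum.valuedAdicCompletion_eq_valuation', hπ]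
  have h1 : Valued.v (galAdicCompletionMap (L := L) (IsCMField.complexConj L) hw a - a) < 1 :=
    lt_of_le_of_lt ((valued_galAdicCompletionMap_sub_self_le_of_mem_integer L v w hw he hτ ha).trans
      (valued_galAdicCompletionMap_sub_self_le_exp_neg_one L v w hw hτ)) (by rw [← WithZero.exp_zero, WithZero.exp_lt_exp]; norm_num)
  have h2a : Valued.v (2 * a) < 1 := by
    rw [map_mul]
    exact lt_of_le_of_lt (mul_le_of_le_one_right' ha) h2
  rw [show a + galAdicCompletionMap (L := L) (IsCMField.complexConj L) hw a = (galAdicCompletionMap (L := L) (IsCMField.complexConj L) hw a - a) + 2 * a by ring]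
  exact Valued.v.map_add_lt h1 h2a

end CM

end Summit.HodgeConjecture.HodgeConjecture.Cruxes.H413.K2E3LevelNWildCellNoWitness

end
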